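import Literature.AnabelianGeometry.Anabelioids.TrivialObjectFibre

/-!
# Sections of a subobject of a trivial object `∐_J 1` of a Galois category

Mathlib-level lemmas for the anabelioid dictionary ([SGA1, Exp. V §4–5]), phrased INTRINSICALLY
(no `Subobject`, no fibre functor in the hypotheses) and universe-polymorphically (the set of
sheets `J : Type w'` and the fibre functor `F : C ⥤ FintypeCat.{w}` live in unrelated universes —
the graph-of-anabelioids applications have `J` a fibre of a map of semi-graphs and `F` a fibre
functor of a constituent anabelioid).  For a Galois category `C`, a finite `J` and a monomorphism
`m : Y ↪ ∐_{j ∈ J} 1`, "the sheet `j` lies in `Y`" means: `1 ⟶_j ∐ 1` factors through `m`.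

* `TrivialObj.not_isInitial`: `∐_J 1` is not initial when `J` is nonempty;
* `TrivialObj.exists_eq_map_ι`, `TrivialObj.autApp_eq`: every fibre point of `∐_J 1` is the point
  of a sheet, so `Aut F` acts trivially on `F (∐_J 1)`;
* `TrivialObj.factors_iff_mem_range`: the sheet `j` lies in `Y` iff its fibre point is in the
  image of `F m` (read on ANY fibre functor `F`);
* `TrivialObj.isIso_of_forall_factors` / `TrivialObj.isInitial_of_forall_not_factors`: if every
  (resp. no) sheet lies in `Y`, then `m` is an isomorphism (resp. `Y` is initial).

Proof-only, no definitions.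
-/

namespace Literature.AnabelianGeometry.Anabelioids

namespace TrivialObj

open CategoryTheory CategoryTheory.Limits CategoryTheory.PreGaloisCategory

universe w w' u₂ u₁

variable {C : Type u₁} [Category.{u₂} C] [GaloisCategory C] {J : Type w'} [Finite J]

/-- A trivial object `∐_J 1` with at least one sheet is not initial (the fibre of `1` is a point,
the fibre of an initial object is empty). [cite: SGA1, Exp. V §4 (condition (G4))] -/
theorem not_isInitial (j : J) : IsInitial (∐ fun _ : J => ⊤_ C) → False := by
  intro hI
  let F := GaloisCategory.getFiberFunctor C
  obtain ⟨e⟩ := nonempty_equiv_fiber_terminal_punit F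
  exact ((initial_iff_fiber_empty F _).mp ⟨hI⟩).false
    (F.map (Sigma.ι (fun _ : J => ⊤_ C) j) (e.symm PUnit.unit))

variable (F : C ⥤ FintypeCat.{w}) [FiberFunctor F]

/-- Every point of the fibre of `∐_J 1` is the fibre point of some sheet. [cite: SGA1, Exp. V §5] -/
theorem exists_eq_map_ι (t : F.obj (⊤_ C)) (x : F.obj (∐ fun _ : J => ⊤_ C)) :
    ∃ j : J, x = F.map (Sigma.ι (fun _ : J => ⊤_ C) j) t := by
  haveI := subsingleton_fiber_terminal F
  obtain ⟨⟨j⟩, y, hy⟩ := Concrete.isColimit_exists_rep _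
    (isColimitOfPreserves F (colimit.isColimit (Discrete.functor fun _ : J => ⊤_ C))) x
  obtain ⟨y, rfl⟩ : ∃ y' : F.obj (⊤_ C), y' = y := ⟨y, rfl⟩
  refine ⟨j, ?_⟩
  rw [← hy, Subsingleton.elim y t]
  rfl

/-- **`Aut F` acts trivially on the fibre of `∐_J 1`.** [cite: SGA1, Exp. V §5] -/
theorem autApp_eq (σ : Aut F) (x : F.obj (∐ fun _ : J => ⊤_ C)) :
    σ.hom.app (∐ fun _ : J => ⊤_ C) x = x := by
  haveI := subsingleton_fiber_terminal F
  obtain ⟨t⟩ := (nonempty_equiv_fiber_terminal_punit F).map fun e => e.symm PUnit.unit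
  obtain ⟨j, rfl⟩ := exists_eq_map_ι F t x
  exact app_map_eq_of_subsingleton F σ (Sigma.ι (fun _ : J => ⊤_ C) j) t

variable {F}

/-- **The sheets of a subobject of `∐_J 1` are read on the fibre**: for a monomorphism
`m : Y ↪ ∐_J 1`, the sheet `1 ⟶_j ∐_J 1` factors through `m` iff its fibre point is in the image of
`F m`. [cite: SGA1, Exp. V §5] -/
theorem factors_iff_mem_range {Y : C} (m : Y ⟶ ∐ fun _ : J => ⊤_ C) [Mono m] (j : J)
    (t : F.obj (⊤_ C)) :
    (∃ f : ⊤_ C ⟶ Y, f ≫ m = Sigma.ι (fun _ : J => ⊤_ C) j) ↔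
      F.map (Sigma.ι (fun _ : J => ⊤_ C) j) t ∈ Set.range (F.map m) := by
  constructor
  · rintro ⟨f, hf⟩
    refine ⟨F.map f t, ?_⟩
    change (F.map f ≫ F.map m) t = _
    rw [← F.map_comp, hf]
  · rintro ⟨y, hy⟩
    haveI : Mono (Sigma.ι (fun _ : J => ⊤_ C) j) :=
      MonoCoprod.mono_inj (fun _ : J => ⊤_ C) (colimit.cocone (Discrete.functor fun _ : J => ⊤_ C))
        (colimit.isColimit _) j
    haveI : IsConnected (⊤_ C) := isConnected_terminal
    haveI := subsingleton_fiber_terminal F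
    -- the connected component of `Y` through `y` is the sheet `j`
    obtain ⟨Z, i, z, hz, hZ, hi⟩ := fiber_in_connected_component F Y y
    haveI := hZ
    haveI := hi
    haveI : Mono (i ≫ m) := mono_comp _ _
    have h1 : F.map (i ≫ m) z = F.map (Sigma.ι (fun _ : J => ⊤_ C) j) t := by
      rw [F.map_comp]
      change F.map m (F.map i z) = _
      rw [hz, hy]
    obtain ⟨f, hf⟩ := connected_component_unique F z t (i ≫ m) (Sigma.ι (fun _ : J => ⊤_ C) j) h1
    have hcomm : f.hom ≫ Sigma.ι (fun _ : J => ⊤_ C) j = i ≫ m := by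
      apply F.map_injective
      obtain ⟨e⟩ := nonempty_equiv_fiber_terminal_punit F
      have hsub : Subsingleton (F.obj Z) :=
        ((FintypeCat.incl.mapIso (F.mapIso f)).toEquiv.trans e).subsingleton
      ext x
      rw [Subsingleton.elim x z, F.map_comp]
      change F.map (Sigma.ι (fun _ : J => ⊤_ C) j) (F.map f.hom z) = F.map (i ≫ m) z
      rw [hf, h1]
    exact ⟨f.inv ≫ i, by rw [Category.assoc, ← hcomm, Iso.inv_hom_id_assoc]⟩

omit [FiberFunctor F] in
variable (F) in
/-- A factorisation of the sheet `j` through `m` exhibits its fibre point in the image of `F m`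
(the easy direction, for any functor `F`). [cite: SGA1, Exp. V §5] -/
theorem mem_range_of_factors {Y : C} (m : Y ⟶ ∐ fun _ : J => ⊤_ C) (j : J) (t : F.obj (⊤_ C))
    (h : ∃ f : ⊤_ C ⟶ Y, f ≫ m = Sigma.ι (fun _ : J => ⊤_ C) j) :
    F.map (Sigma.ι (fun _ : J => ⊤_ C) j) t ∈ Set.range (F.map m) := by
  obtain ⟨f, hf⟩ := h
  refine ⟨F.map f t, ?_⟩
  change (F.map f ≫ F.map m) t = _
  rw [← F.map_comp, hf]

/-- **If every sheet lies in the subobject `m : Y ↪ ∐_J 1`, then `m` is an isomorphism.**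
[cite: SGA1, Exp. V §5] -/
theorem isIso_of_forall_factors {Y : C} (m : Y ⟶ ∐ fun _ : J => ⊤_ C) [Mono m]
    (h : ∀ j : J, ∃ f : ⊤_ C ⟶ Y, f ≫ m = Sigma.ι (fun _ : J => ⊤_ C) j) : IsIso m := by
  let F := GaloisCategory.getFiberFunctor C
  obtain ⟨t⟩ := (nonempty_equiv_fiber_terminal_punit F).map fun e => e.symm PUnit.unit
  apply isIso_of_mono_of_eq_card_fiber F m
  have hinj : Function.Injective (F.map m) :=
    ConcreteCategory.injective_of_mono_of_preservesPullback (F.map m)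
  have hsurj : Function.Surjective (F.map m) := by
    intro x
    obtain ⟨j, rfl⟩ := exists_eq_map_ι F t x
    obtain ⟨y, hy⟩ := mem_range_of_factors F m j t (h j)
    exact ⟨y, hy⟩
  exact Nat.card_congr (Equiv.ofBijective _ ⟨hinj, hsurj⟩)

/-- **If no sheet lies in the subobject `m : Y ↪ ∐_J 1`, then `Y` is initial.**
[cite: SGA1, Exp. V §5] -/
theorem isInitial_of_forall_not_factors {Y : C} (m : Y ⟶ ∐ fun _ : J => ⊤_ C) [Mono m]
    (h : ∀ j : J, ¬ ∃ f : ⊤_ C ⟶ Y, f ≫ m = Sigma.ι (fun _ : J => ⊤_ C) j) :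
    Nonempty (IsInitial Y) := by
  let F := GaloisCategory.getFiberFunctor C
  obtain ⟨t⟩ := (nonempty_equiv_fiber_terminal_punit F).map fun e => e.symm PUnit.unit
  rw [initial_iff_fiber_empty F]
  constructor
  intro y
  obtain ⟨j, hj⟩ := exists_eq_map_ι F t (F.map m y)
  exact h j ((factors_iff_mem_range m j t).mpr ⟨y, hj⟩)

end TrivialObj

end Literature.AnabelianGeometry.Anabelioids
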